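import Literature.IUT.HodgeArakelov.CoreTowerFlPMQuotient
import Literature.IUT.HodgeArakelov.CoreTowerNonVacuityUnderline
import Literature.IUT.HodgeArakelov.FlSymmetryModelAbelian
import HarnessLib

/-!
# [IUTchII] Rmk. 1.1.1 (iv): the two `W`-clauses of `FlSymmetry` hold at the GENUINE [EtTh] core tower — `FlSymmetry`
# inhabited at the genuine frame

Mochizuki, *Inter-universal Teichmüller theory II*, §1, Remark 1.1.1 (iv), kurims manuscript (Dec. 2020) pp. 23–24:
«the mono-theta-theoretic cyclotomic rigidity isomorphism … admits a certain symmetry with respect to the group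
`Δ_C(M^Θ)/Δ_X̲(M^Θ) ≅ 𝔽_l^{⋊±}` [cf. [IUTchI], Definition 6.1, (v)]» [claim: Mochizuki2012, status: disputed]
(IUTchII §1 Rmk 1.1.1 (iv), kurims pp.23-24). [cite: MochizukiEtTh2009, Def 2.1 p.36]

abc-iut cell, layer L6, NV-L6 row **FlSymmetry**, seat abc-iut-w4-d019 (gen 3), by-name row «FLSYM-GENUINE», part 2 of 2
(part 1 = `CoreTowerFlPMQuotient.lean`: the group theory `Δ_C/Δ_X̲ ≃* 𝔽_l^{⋊±}` inside `Π^tp_C` under the (R1c) clause).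
abc-iut-w5-d225's TYPED FINDING 2026-08-26T10:49:57Z named the two clauses as «NOT attempted by me». PROOF-ONLY
(0 `def` / `instance` / `structure`).

WHAT IS PROVED. abc-iut-w5-d219's `FlSymmetry.nonempty_iff` (p419429) reduces the Rmk. 1.1.1 (iv) record
`FlSymmetry Sec` over `(R, T, W, Sec)` to three structural clauses; the abelian clause is discharged at the model by
`ModelFrame.flSymmetry_nonempty_of_coreTower` (p420767), leaving the two clauses on the core tower `W`:
`Δ_X(M) := W.X ⊓ Δ_C(M)` normal in `Δ_C(M)` and `Δ_C(M)/Δ_X(M) ≅ 𝔽_l^{⋊±}`. abc-iut-w5-d225's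
`ModelFrame.exists_coreTower_of_cLevelData'` (p437733) inhabits `CoreTower (F.reconstruction e)` at the genuine [EtTh]
model frame with `W.PiC = Π^tp_C` and field `X := inclX(toZ⁻¹(l·ℤ)) = Π_X̲` (the `𝔽_l^{⋊±}`-compatible reading of the
undecorated display of Rmk. 1.1.1 (i), documented there). Here:

* `ModelFrame.exists_coreTower_flPM_of_cLevelData` — under p437733's binders (`cl`, `hO`, `hYcl`) and the (R1c) clause
  `hR1c : ∀ x, toZ (cl.conjX ε_± x) = (toZ x)⁻¹` («the inversion acts by `−1` on `Z`», [EtTh] p. 36; abc-iut-w5-d072's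
  shape), the genuine tower — SAME four pins `PiC`, `kerEll`, `Xbar`, `X` as p437733, construction repeated verbatim
  because the `∃`-statement of p437733 does not pin `projG` (hence not `Δ_C(M) = Ker projG`) — satisfies BOTH
  `W`-clauses: `(W.DeltaXplain.subgroupOf W.DeltaC).Normal` and
  `Nonempty (W.DeltaC ⧸ W.DeltaXplain.subgroupOf W.DeltaC ≃* FlPM l)`, by part 1's
  `MuTwoSetting.CLevelData.normal_and_nonempty_quotient_mulEquiv_flPM` applied to `Δ_C(M) = Ker(π) = Ker(augC)`;
* `ModelFrame.exists_coreTower_flSymmetry_of_cLevelData` — when the setting's prime is the `l` of the [EtTh] data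
  (`hlS : S.l = l`), for every theta-quotient datum `T` whose theta section is the model one (abc-iut-w4-d030; w5-d219's
  binder `hT`) and EVERY two-sections datum `Sec : TwoSections T W` (abc-iut-w5-d225's pending `TwoSectionsNonVacuity`
  supplies one; here it is a binder), the Rmk. 1.1.1 (iv) record `FlSymmetry Sec` is INHABITED — NV-L6 row FlSymmetry
  at the GENUINE frame (action data DEGENERATE = trivial actions, as labelled in `FlSymmetry.nonempty_of`).

BINDER CENSUS (by name; no `Prop` fact introduced, no FACT-LIST row consumed): p437733's `cl : Mt.CLevelData`,
`hO : IsEtThOrigin`, `hYcl` VERBATIM; `hR1c` (printed clause in the registered (R1c) shape, kernel-inhabited at the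
inversion model `SettingModel.toZ_conjX_epsPM_inversionModel`); for the corollary `hlS : S.l = l` and `hT`.
HONEST FRAMING: kernel facts about the cell's own typed interfaces; the decoration reading of Rmk. 1.1.1 (i) is
p437733's; nothing of [IUTchII] is asserted; Rmk. 1.1.1 is outside the [IUTchIII] Cor. 3.12 cone; no side taken on
Cor. 3.12; typed ≠ proved; witnessed ≠ discharged.
-/

noncomputable section

/-! ## §2. The genuine `𝔽_l^{⋊±}`-compatible core tower satisfies the two W-clauses of `FlSymmetry` -/

namespace Literature.IUT.HodgeArakelov

open Literature.AnabelianGeometry.EtaleTheta Literature.AnabelianGeometry.SemiGraphs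
open scoped Literature.AnabelianGeometry.EtaleTheta

namespace ModelFrame

variable {p : ℕ} [Fact p.Prime] {Mt : MuTwoSetting p}
  {E : Mt.toThetaSetting.EtaleThetaData} {l : ℕ} (C : E.DoubleUnderline l)
  {S : ThetaSetting.{0}} (μ : Mt.toThetaSetting.CyclotomeMod l S.N)
  (hC : Mt.toThetaSetting.Compat) (hS : Mt.toThetaSetting.Sec2Hyps)
  (h15 : ThetaSetting.Prop15iii E hC) (L : C.CuspLabels)
  (F : ModelFrame S (C.rigidData μ hC hS h15 L)) {Menv : MonoThetaEnv S}
  (e : Menv.Pi ≃ₜ* (C.rigidData μ hC hS h15 L).env)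

/-- **IUTchII:Rmk1.1.1(iv) — the genuine core tower of p437733 SATISFIES the two `W`-clauses of `FlSymmetry`.**
Under p437733's binders and the (R1c) clause `hR1c` («the inversion acts by `−1` on `Z`»), the core tower over the
Def. 1.1 (i) output of the [EtTh] model frame with `W.PiC = Π^tp_C`, `W.X = inclX(toZ⁻¹(l·ℤ)) = Π_X̲`,
`W.Xbar = Π^tp_X` (same four pins as `exists_coreTower_of_cLevelData'`, same construction) has `Δ_X(M) ⊴ Δ_C(M)` and
`Δ_C(M)/Δ_X(M) ≃* 𝔽_l^{⋊±}` («`Δ_C(M^Θ)/Δ_X̲(M^Θ) ≅ 𝔽_l^{⋊±}` [cf. [IUTchI], Definition 6.1, (v)]», p. 23).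
[claim: Mochizuki2012, status: disputed] (IUTchII §1 Rmk 1.1.1 (iv), kurims p.23) -/
theorem exists_coreTower_flPM_of_cLevelData (cl : Mt.CLevelData) (hO : Mt.toThetaSetting.IsEtThOrigin)
    (hYcl : (Mt.DtpY.map Mt.toHat.toMonoidHom).topologicalClosure ≤
      Mt.DtpY.map Mt.toHat.toMonoidHom ⊔ (⁅⁅Mt.DeltaHat, Mt.DeltaHat⁆, Mt.DeltaHat⁆).topologicalClosure)
    (hR1c : ∀ x : Mt.PiTemp, Mt.toZ (cl.conjX Mt.epsPM x) = (Mt.toZ x)⁻¹) :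
    ∃ W : CoreTower (F.reconstruction e), W.PiC = TopGroup.of Mt.GtpC ∧
      W.kerEll = ((Mt.thetaToEll.comp Mt.toTheta).ker).comap
        (C.Huu.subtype.comp (Mt.GtpY.subgroupOf C.Huu).subtype) ∧
      HEq W.Xbar Mt.inclX.range ∧
      HEq W.X (((Subgroup.zpowers (Multiplicative.ofAdd (l : ℤ))).comap Mt.toZ).map Mt.inclX) ∧
      ∃ _hN : (W.DeltaXplain.subgroupOf W.DeltaC).Normal,
        Nonempty (W.DeltaC ⧸ W.DeltaXplain.subgroupOf W.DeltaC ≃* Literature.IUT.HodgeTheaters.FlPM l) := by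
  classical
  -- ### notation
  set R : RigidData S.N l := C.rigidData μ hC hS h15 L with hRdef
  have hι : Topology.IsOpenEmbedding Mt.inclX := cl.isOpenEmbedding_inclX
  -- ### `(Δ^tp_{Y̲̲})^ell ≅ Ẑ` (abc-iut-w5-d024, `Discharge/Sec1DeltaYuuEllZHat`)
  obtain ⟨eδ⟩ := C.nonempty_deltaYuuEll_mulEquiv_zHat hO hYcl
  -- ### the open embedding `Π^tp_{X̲̲} ≃ₜ* inclX(Π^tp_{X̲̲})`
  have hmemrange : ∀ y : ↥(C.Huu.map Mt.inclX), (y : Mt.GtpC) ∈ Mt.inclX.range := fun y =>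
    Subgroup.map_le_range _ _ y.2
  have hinv_mem : ∀ y : ↥(C.Huu.map Mt.inclX),
      (MonoidHom.ofInjective Mt.injective_inclX).symm ⟨y, hmemrange y⟩ ∈ C.Huu := by
    intro y
    obtain ⟨x, hx, hxy⟩ := Subgroup.mem_map.1 y.2
    have : (MonoidHom.ofInjective Mt.injective_inclX).symm ⟨y, hmemrange y⟩ = x :=
      Mt.injective_inclX (by rw [MonoidHom.apply_ofInjective_symm]; exact hxy.symm)
    rw [this]; exact hx
  let iX : ↥C.Huu ≃ₜ* ↥(C.Huu.map Mt.inclX) :=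
    { toFun := fun x => ⟨Mt.inclX x, Subgroup.mem_map_of_mem Mt.inclX x.2⟩
      invFun := fun y => ⟨(MonoidHom.ofInjective Mt.injective_inclX).symm ⟨y, hmemrange y⟩, hinv_mem y⟩
      left_inv := fun x => by
        apply Subtype.ext
        apply Mt.injective_inclX
        simp only [MonoidHom.apply_ofInjective_symm]
      right_inv := fun y => by
        apply Subtype.ext
        simp only [MonoidHom.apply_ofInjective_symm]
      map_mul' := fun x y => Subtype.ext (by simp only [Subgroup.coe_mul, map_mul])
      continuous_toFun := (Mt.continuous_inclX.comp continuous_subtype_val).subtype_mk _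
      continuous_invFun := by
        apply Continuous.subtype_mk
        exact cl.continuous_ofInjective_symm.comp (continuous_subtype_val.subtype_mk _) }
  -- ### the surjection `Π^tp_C ↠ G(M) = Π^tp_{X̲̲}/Δ ≅ G_K`
  have haugC_mem : ∀ g : Mt.GtpC, cl.augC g ∈ Mt.GK := fun g => by
    rw [← cl.range_augC]; exact ⟨g, rfl⟩
  let aC : Mt.GtpC →* ↥Mt.GK := cl.augC.toMonoidHom.codRestrict Mt.GK haugC_mem
  have aC_surj : Function.Surjective aC := by
    intro γ
    have hγ : (γ : GQp p) ∈ cl.augC.range := by rw [cl.range_augC]; exact γ.2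
    obtain ⟨g, hg⟩ := hγ
    exact ⟨g, Subtype.ext hg⟩
  let eG : (↥C.Huu ⧸ R.aug.ker) ≃* ↥Mt.GK :=
    QuotientGroup.quotientKerEquivOfSurjective R.aug R.aug_surjective
  have eG_mk : ∀ x : ↥C.Huu, eG (QuotientGroup.mk x) = R.aug x := fun _ => rfl
  let π : Mt.GtpC →* (↥C.Huu ⧸ R.aug.ker) := eG.symm.toMonoidHom.comp aC
  -- ### `Ker(Π_Y(M) ↠ Π^ell_Y(M))` : `Ker(Π^tp_X ↠ (Π^tp_X)^ell)` pulled back to `Π_Y(M) = Π^tp_{Y̲̲}`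
  let K₀ : Subgroup Mt.PiTemp := (Mt.thetaToEll.comp Mt.toTheta).ker
  let kerEll : Subgroup ↥(Mt.GtpY.subgroupOf C.Huu) :=
    K₀.comap (C.Huu.subtype.comp (Mt.GtpY.subgroupOf C.Huu).subtype)
  haveI hK₀n : K₀.Normal := MonoidHom.normal_ker _
  haveI hkn : kerEll.Normal := Subgroup.Normal.comap hK₀n _
  -- ### transport `Δ_Y(M) ≃* Π^tp_{X̲̲} ∩ Δ^tp_Y` (tautological: both are `{x ∈ Π^tp_{X̲̲} ∩ Π^tp_Y | aug x = 1}`)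
  let φ : ↥(F.reconstruction e).DeltaY ≃* ↥(C.Huu ⊓ Mt.DtpY) :=
    { toFun := fun y => ⟨((y.1 : ↥C.Huu) : Mt.PiTemp),
        ⟨(y.1 : ↥C.Huu).2, ⟨Subgroup.mem_subgroupOf.1 y.1.2,
          (mem_deltaY_reconstruction_iff C μ hC hS h15 L F e y.1).1 y.2⟩⟩⟩
      invFun := fun z => ⟨⟨⟨z.1, z.2.1⟩, Subgroup.mem_subgroupOf.2 z.2.2.1⟩,
        (mem_deltaY_reconstruction_iff C μ hC hS h15 L F e _).2 z.2.2.2⟩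
      left_inv := fun _ => rfl
      right_inv := fun _ => rfl
      map_mul' := fun _ _ => rfl }
  have hφ : Subgroup.map (↑φ) (kerEll.subgroupOf (F.reconstruction e).DeltaY) =
      K₀.subgroupOf (C.Huu ⊓ Mt.DtpY) := by
    ext z
    constructor
    · rintro ⟨y, hy, rfl⟩
      exact hy
    · intro hz
      exact ⟨φ.symm z, hz, φ.apply_symm_apply z⟩
  haveI : (K₀.subgroupOf (C.Huu ⊓ Mt.DtpY)).Normal := inferInstance
  haveI : (kerEll.subgroupOf (F.reconstruction e).DeltaY).Normal := inferInstance
  -- ### the two `𝔽_l^{⋊±}`-clauses for `Δ_C(M) := Ker(π)` (§1, under (R1c))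
  have hkerπ : π.ker = cl.augC.toMonoidHom.ker := by
    ext g
    rw [MonoidHom.mem_ker, MonoidHom.mem_ker, MonoidHom.comp_apply, MulEquiv.coe_toMonoidHom,
      MulEquiv.map_eq_one_iff]
    constructor
    · intro h
      have h' := congrArg (fun γ : ↥Mt.GK => (γ : GQp p)) h
      exact h'
    · intro h
      exact Subtype.ext h
  have hflpm := cl.normal_and_nonempty_quotient_mulEquiv_flPM hR1c l π.ker hkerπ
  -- ### assembly
  refine ⟨{ PiC := TopGroup.of Mt.GtpC
            Y := (C.Huu ⊓ Mt.GtpY).map Mt.inclX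
            Xbar := Mt.inclX.range
            X := ((Subgroup.zpowers (Multiplicative.ofAdd (l : ℤ))).comap Mt.toZ).map Mt.inclX
            Xbarbar := C.Huu.map Mt.inclX
            Y_le_Xbar := Subgroup.map_le_range _ _
            Xbarbar_le_X := ?_
            Y_le_Xbarbar := Subgroup.map_mono inf_le_left
            isOpen_Y := ?_
            isOpen_Xbar := Mt.isOpen_range_inclX
            isOpen_X := ?_
            isOpen_Xbarbar := ?_
            isoXbarbar := iX
            isoXbarbar_Y := ?_
            projG := π
            projG_surjective := eG.symm.surjective.comp aC_surj
            projG_compat := ?_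
            kerEll := kerEll
            kerEll_normal := hkn
            deltaEll_iso := ⟨(QuotientGroup.congr _ _ φ hφ).trans eδ⟩
            deltaEll_normal := inferInstance }, rfl, rfl, HEq.rfl, HEq.rfl, hflpm⟩
  · -- `Π_X̲̲ ⊆ Π_X̲` : `toZ(Π^tp_{X̲̲}) = l·ℤ` ([EtTh] Def. 2.5 (i), `DoubleUnderline.map_toZ_Huu`)
    refine Subgroup.map_mono fun x hx => ?_
    rw [Subgroup.mem_comap, ← C.map_toZ_Huu]
    exact Subgroup.mem_map_of_mem _ hx
  · -- `Π_Y` open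
    rw [Subgroup.coe_map]
    exact hι.isOpenMap _ (C.isOpen_Huu.inter Mt.toThetaSetting.isOpen_ker_toZ)
  · -- `Π_X̲` open : it contains the open subgroup `Ker(toZ)`
    rw [Subgroup.coe_map]
    refine hι.isOpenMap _ (Subgroup.isOpen_mono ?_ Mt.toThetaSetting.isOpen_ker_toZ)
    intro x hx
    have hx1 : Mt.toZ x = 1 := hx
    simp only [Subgroup.mem_comap, hx1, one_mem]
  · -- `Π_X̲̲` open
    rw [Subgroup.coe_map]
    exact hι.isOpenMap _ C.isOpen_Huu
  · -- `isoXbarbar` carries `Π_Y(M) = Π^tp_Y ∩ Π^tp_{X̲̲}` onto `Π_Y = inclX(Π^tp_{X̲̲} ∩ Π^tp_Y)`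
    ext g
    constructor
    · intro hg
      obtain ⟨y, hy, hyg⟩ := Subgroup.mem_map.1 hg
      obtain ⟨y', hy'⟩ := MonoidHom.mem_range.1 hy
      subst hy'
      subst hyg
      exact Subgroup.mem_map.2
        ⟨((y' : ↥C.Huu) : Mt.PiTemp), ⟨(y' : ↥C.Huu).2, Subgroup.mem_subgroupOf.1 y'.2⟩, rfl⟩
    · intro hg
      obtain ⟨x, hx, hxg⟩ := Subgroup.mem_map.1 hg
      subst hxg
      exact Subgroup.mem_map.2 ⟨⟨x, hx.1⟩,
        MonoidHom.mem_range.2 ⟨⟨⟨x, hx.1⟩, Subgroup.mem_subgroupOf.2 hx.2⟩, rfl⟩, rfl⟩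
  · -- compatibility of `Π_C ↠ G(M)` with `Π_X(M) ↠ G(M)` : `augC ∘ inclX = aug`
    intro x
    change eG.symm (aC (Mt.inclX x)) = QuotientGroup.mk x
    rw [MulEquiv.symm_apply_eq, eG_mk]
    apply Subtype.ext
    change cl.augC (Mt.inclX x) = _
    rw [cl.augC_inclX]
    rfl


/-- **IUTchII:Rmk1.1.1(iv) — `FlSymmetry` INHABITED at the GENUINE [EtTh] core tower** (NV-L6 row FlSymmetry,
genuine frame): when the setting's prime is the `l` of the [EtTh] data (`hlS : S.l = l`), under the binders of
`exists_coreTower_flPM_of_cLevelData`, there is a core tower `W` over `F.reconstruction e` with the four pins of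
p437733 such that for every theta-quotient datum `T` whose theta section is the model one (abc-iut-w4-d030) and
EVERY two-sections datum `Sec : TwoSections T W`, the Rmk. 1.1.1 (iv) record `FlSymmetry Sec` is inhabited
(abc-iut-w5-d219's `flSymmetry_nonempty_of_coreTower`: abelian clause at the model + the two W-clauses proved here;
action data DEGENERATE as labelled there). [claim: Mochizuki2012, status: disputed] (IUTchII §1 Rmk 1.1.1 (iv), kurims pp.23-24) -/
theorem exists_coreTower_flSymmetry_of_cLevelData (cl : Mt.CLevelData) (hO : Mt.toThetaSetting.IsEtThOrigin)
    (hYcl : (Mt.DtpY.map Mt.toHat.toMonoidHom).topologicalClosure ≤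
      Mt.DtpY.map Mt.toHat.toMonoidHom ⊔ (⁅⁅Mt.DeltaHat, Mt.DeltaHat⁆, Mt.DeltaHat⁆).topologicalClosure)
    (hR1c : ∀ x : Mt.PiTemp, Mt.toZ (cl.conjX Mt.epsPM x) = (Mt.toZ x)⁻¹) (hlS : S.l = l) :
    ∃ W : CoreTower (F.reconstruction e), W.PiC = TopGroup.of Mt.GtpC ∧
      W.kerEll = ((Mt.thetaToEll.comp Mt.toTheta).ker).comap
        (C.Huu.subtype.comp (Mt.GtpY.subgroupOf C.Huu).subtype) ∧
      HEq W.Xbar Mt.inclX.range ∧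
      HEq W.X (((Subgroup.zpowers (Multiplicative.ofAdd (l : ℤ))).comap Mt.toZ).map Mt.inclX) ∧
      ∀ (T : ThetaQuotientData (F.reconstruction e)),
        T.thetaSection = (((C.rigidData μ hC hS h15 L).thetaKer.subgroupOf (C.rigidData μ hC hS h15 L).PiY).map
          (CycEnvelope.algSection (C.rigidData μ hC hS h15 L).augY (C.rigidData μ hC hS h15 L).chi)).comap
            e.toMulEquiv.toMonoidHom →
        ∀ Sec : TwoSections T W, Nonempty (FlSymmetry Sec) := by
  obtain ⟨W, h1, h2, h3, h4, hN, hq⟩ := exists_coreTower_flPM_of_cLevelData C μ hC hS h15 L F e cl hO hYcl hR1c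
  refine ⟨W, h1, h2, h3, h4, fun T hT Sec => ?_⟩
  have hq' : Nonempty (W.DeltaC ⧸ W.DeltaXplain.subgroupOf W.DeltaC ≃* Literature.IUT.HodgeTheaters.FlPM S.l) := by
    rw [hlS]
    exact hq
  exact flSymmetry_nonempty_of_coreTower F e T hT W Sec hN hq'

end ModelFrame

end Literature.IUT.HodgeArakelov

end
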